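import Literature.NumberTheory.LFunctions.MatomakiRadziwillTaoTheoremA2
import HarnessLib

/-!
# Matomäki–Radziwiłł–Tao 2015, Theorem A.2 with an abstract middle term (hypothesis schema)

Topic `Literature/NumberTheory/LFunctions`.  This small file introduces ONE definition, a hypothesis
SCHEMA (a `Prop` depending on a parameter `mid : ℝ → ℝ`), and proves that the tree's named fact
`MatomakiRadziwillTao2015_theoremA2` instantiates it; it introduces no named fact.

`MatomakiRadziwillTao2015_theoremA2` (K. Matomäki, M. Radziwiłł, T. Tao, Algebra & Number Theory 9 (2015),
Appendix A, Theorem A.2; `MatomakiRadziwillTaoTheoremA2.lean`) bounds the mean square of the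
`𝒮`-restricted short sums of a `1`-bounded multiplicative `f` by
`C ((1 + M) e^{-M} + (log h)^{1/3}/P₁^{1/6-η} + (log X)^{-1/50})`, `M = M(f; X)`.  Downstream
(`MRT2015.winL1_typical_le` → `majorArc_le` → Theorem 2.3 → Theorem 1.7 → Tao 2016, Prop. 2.4) the theorem
is used only for COMPLETELY multiplicative functions (`twistChar g χ`, `g` completely multiplicative) and
only through the size of its middle term at `M_low = 3 log W - 48`.  On the other hand the only route to
Theorem A.2 available in this library — Halász's theorem for block-restricted sums
(`Halasz.Restricted.norm_restr_sum_le`) near the minimising twist `t₁` — yields the middle term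
`(1 + M) e^{-M/2}` rather than `(1 + M) e^{-M}` (see the module docstrings of `TwistedPrimeSumTail.lean`,
"Remark on the regions `𝒯₀ ∪ 𝒯₁`", and of `MatomakiRadziwillTaoSiftedDistance.lean`, "Status").  To let
the major-arc chain be re-run from whichever form of Theorem A.2 gets proved, we isolate its conclusion
with an abstract middle term:

* `MRT2015.TheoremA2With mid` — "Theorem A.2 holds for completely multiplicative `1`-bounded `f` with
  the middle term `mid (M(f; X))`": the statement of `MatomakiRadziwillTao2015_theoremA2` verbatim
  (same interval systems `SieveIntervalSystem η X₀`, same `shortSumA2`, same quantifier shape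
  `∀ η ∈ (0, 1/6), ∃ C Xη, ∀ X X₀ h I f, …`), except that `f.IsMultiplicative` is strengthened to
  complete multiplicativity (`∀ m n, f (m n) = f m · f n`, `f 1 = 1`) and `(1 + M) e^{-M}` is replaced
  by `mid M`;
* `MRT2015.theoremA2With_of_theoremA2` — the named fact gives the schema with `mid M = (1 + M) e^{-M}`;
* `MRT2015.TheoremA2With.mono` — monotonicity in `mid` (pointwise larger middle terms, on `M ≥ 0`
  and for `mid ≥ 0`, give weaker schemas), e.g. `TheoremA2With (fun M => (1+M) e^{-M}) → TheoremA2With (fun M => 2 e^{-M/3})`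
  (`theoremA2With_exp_neg_third_of_theoremA2`).

## References
* K. Matomäki, M. Radziwiłł, T. Tao, *An averaged form of Chowla's conjecture*, Algebra & Number Theory
  9 (2015), 2167–2196; arXiv:1503.05121: Appendix A, Theorem A.2; §4 (its use on the major arcs).
  [cite: MatomakiRadziwillTao2015, Appendix A, Theorem A.2]

## Design choices
* A parametrised `Prop`, only ever taken as a hypothesis `(hA2 : TheoremA2With mid)`; it is not a
  statement of the literature with a fixed truth value and carries no `_holds`.
* Complete multiplicativity is rendered as for `g` in `MRT2015.majorArc_le`
  (`∀ m n : ℕ, f (m * n) = f m * f n` together with `f 1 = 1`, `f : ArithmeticFunction ℂ`).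
-/

noncomputable section

open Finset Real MeasureTheory

namespace Literature.NumberTheory.LFunctions

namespace MRT2015

open Sieve (SieveIntervalSystem minPretentiousDistSq minPretentiousDistSq_nonneg)

/-- **Theorem A.2 with middle term `mid`, for completely multiplicative `f`** (hypothesis schema):
for every `η ∈ (0, 1/6)` there are `C, Xη` such that for all `X > Xη`, `h ≥ 3`, `√X ≤ X₀ ≤ X`, every
interval system `I : SieveIntervalSystem η X₀` with `Q₁ ≤ h`, and every completely multiplicative
`f : ℕ → ℂ` with `|f| ≤ 1`,
`(1/X) ∫_X^{2X} |h⁻¹ ∑_{x ≤ n ≤ x+h, n ∈ 𝒮} f(n)|² dx ≤ C (mid(M(f;X)) + (log h)^{1/3}/P₁^{1/6-η} + (log X)^{-1/50})`,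
`M(f; X) = minPretentiousDistSq f X X`.  With `mid M = (1 + M) e^{-M}` this is the conclusion of
`MatomakiRadziwillTao2015_theoremA2` restricted to completely multiplicative `f`
(`theoremA2With_of_theoremA2`). [cite: MatomakiRadziwillTao2015, Appendix A, Theorem A.2] -/
def TheoremA2With (mid : ℝ → ℝ) : Prop :=
  ∀ η : ℝ, 0 < η → η < 1 / 6 → ∃ C Xη : ℝ, ∀ (X X₀ h : ℝ) (I : SieveIntervalSystem η X₀)
    (f : ArithmeticFunction ℂ), (∀ m n : ℕ, f (m * n) = f m * f n) → f 1 = 1 → (∀ n, ‖f n‖ ≤ 1) →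
    Xη < X → 3 ≤ h → Real.sqrt X ≤ X₀ → X₀ ≤ X → I.Q 1 ≤ h →
    1 / X * ∫ x in X..(2 * X), ‖(h : ℂ)⁻¹ * shortSumA2 f I X h x‖ ^ 2 ≤
      C * (mid (minPretentiousDistSq f X X) +
        Real.log h ^ (1 / 3 : ℝ) / (I.P 1) ^ (1 / 6 - η) + 1 / Real.log X ^ (1 / 50 : ℝ))

/-- **The named fact instantiates the schema**: `MatomakiRadziwillTao2015_theoremA2` gives
`TheoremA2With (fun M => (1 + M) e^{-M})` (a completely multiplicative `f` with `f 1 = 1` is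
multiplicative). [cite: MatomakiRadziwillTao2015, Appendix A, Theorem A.2] -/
theorem theoremA2With_of_theoremA2 (hA2 : MatomakiRadziwillTao2015_theoremA2) :
    TheoremA2With (fun M => (1 + M) * Real.exp (-M)) := by
  intro η hη hη'
  obtain ⟨C, Xη, hC⟩ := hA2 η hη hη'
  refine ⟨C, Xη, fun X X₀ h I f hfm hf1 hfb hX hh hX₀ hX₀X hQ => ?_⟩
  have hf : f.IsMultiplicative := ⟨hf1, fun {m n} _ => hfm m n⟩
  exact hC X X₀ h I f hf hfb hX hh hX₀ hX₀X hQ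

/-- **Monotonicity of the schema in the middle term**: if `0 ≤ mid M ≤ mid' M` for all `M ≥ 0`,
then `TheoremA2With mid → TheoremA2With mid'` (the constant may be taken `≥ 0`, all three error terms
being nonnegative in the range of the statement). [folklore] -/
theorem TheoremA2With.mono {mid mid' : ℝ → ℝ} (hmid0 : ∀ M : ℝ, 0 ≤ M → 0 ≤ mid M)
    (hle : ∀ M : ℝ, 0 ≤ M → mid M ≤ mid' M) (h : TheoremA2With mid) : TheoremA2With mid' := by
  intro η hη hη'
  obtain ⟨C, Xη, hC⟩ := h η hη hη'
  refine ⟨max C 0, max Xη 1, fun X X₀ h' I f hfm hf1 hfb hX hh hX₀ hX₀X hQ => ?_⟩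
  have hXη : Xη < X := lt_of_le_of_lt (le_max_left _ _) hX
  have hX1 : 1 < X := lt_of_le_of_lt (le_max_right _ _) hX
  have key := hC X X₀ h' I f hfm hf1 hfb hXη hh hX₀ hX₀X hQ
  have hM0 : 0 ≤ minPretentiousDistSq f X X := minPretentiousDistSq_nonneg hfb X (by linarith)
  have hP1 : 1 ≤ I.P 1 := I.one_le_P_one
  have hE0 : 0 ≤ Real.log h' ^ (1 / 3 : ℝ) / (I.P 1) ^ (1 / 6 - η) + 1 / Real.log X ^ (1 / 50 : ℝ) := by
    have h2 : 0 ≤ Real.log h' ^ (1 / 3 : ℝ) / (I.P 1) ^ (1 / 6 - η) :=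
      div_nonneg (Real.rpow_nonneg (Real.log_nonneg (by linarith)) _) (Real.rpow_nonneg (by linarith) _)
    have h3 : 0 ≤ 1 / Real.log X ^ (1 / 50 : ℝ) := by
      have := Real.rpow_nonneg (Real.log_nonneg hX1.le) (1 / 50 : ℝ)
      positivity
    linarith
  have hB0 : 0 ≤ mid (minPretentiousDistSq f X X) +
      Real.log h' ^ (1 / 3 : ℝ) / (I.P 1) ^ (1 / 6 - η) + 1 / Real.log X ^ (1 / 50 : ℝ) := by
    linarith [hmid0 _ hM0]
  have hBB' : mid (minPretentiousDistSq f X X) +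
      Real.log h' ^ (1 / 3 : ℝ) / (I.P 1) ^ (1 / 6 - η) + 1 / Real.log X ^ (1 / 50 : ℝ) ≤
      mid' (minPretentiousDistSq f X X) +
      Real.log h' ^ (1 / 3 : ℝ) / (I.P 1) ^ (1 / 6 - η) + 1 / Real.log X ^ (1 / 50 : ℝ) := by
    linarith [hle _ hM0]
  calc _ ≤ C * _ := key
    _ ≤ max C 0 * _ := mul_le_mul_of_nonneg_right (le_max_left _ _) hB0
    _ ≤ max C 0 * _ := mul_le_mul_of_nonneg_left hBB' (le_max_right _ _)

/-- In particular the named fact gives the schema with the weaker middle term `2 e^{-M/3}`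
(`(1 + M) e^{-M} ≤ 2 e^{-M/3}` for `M ≥ 0`). [cite: MatomakiRadziwillTao2015, Appendix A, Theorem A.2] -/
theorem theoremA2With_exp_neg_third_of_theoremA2 (hA2 : MatomakiRadziwillTao2015_theoremA2) :
    TheoremA2With (fun M => 2 * Real.exp (-M / 3)) := by
  refine TheoremA2With.mono (fun M hM => by positivity) (fun M hM => ?_) (theoremA2With_of_theoremA2 hA2)
  -- `(1+M) e^{-M} ≤ 2 e^{-M/3}`: `(1+M) ≤ 2 e^{2M/3}` since `e^{2M/3} ≥ 1 + 2M/3` and `1 + M ≤ 2 + 4M/3`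
  have h1 : 1 + 2 * M / 3 ≤ Real.exp (2 * M / 3) := by
    have := Real.add_one_le_exp (2 * M / 3); linarith
  have h2 : Real.exp (-M) = Real.exp (-M / 3) * (Real.exp (2 * M / 3))⁻¹ := by
    rw [← Real.exp_neg, ← Real.exp_add]; congr 1; ring
  rw [h2]
  have h3 : 0 < Real.exp (2 * M / 3) := Real.exp_pos _
  have h4 : (1 + M) * (Real.exp (2 * M / 3))⁻¹ ≤ 2 := by
    rw [← div_eq_mul_inv, div_le_iff₀ h3]; nlinarith
  have h5 : 0 < Real.exp (-M / 3) := Real.exp_pos _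
  calc (1 + M) * (Real.exp (-M / 3) * (Real.exp (2 * M / 3))⁻¹)
      = Real.exp (-M / 3) * ((1 + M) * (Real.exp (2 * M / 3))⁻¹) := by ring
    _ ≤ Real.exp (-M / 3) * 2 := mul_le_mul_of_nonneg_left h4 h5.le
    _ = 2 * Real.exp (-M / 3) := by ring

end MRT2015

end Literature.NumberTheory.LFunctions

end
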